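import Summits.QuantumFields.BalabanUV.T4Continuum.Support.MinimalActionHexDictionary
import Literature.MathematicalPhysics.QuantumFieldTheory.Balaban1983to89.B8Lemma1NonAbelian
import Literature.MathematicalPhysics.QuantumFieldTheory.Balaban1983to89.B7Prop9General
import Literature.Analysis.Complex.RungeUnits
import HarnessLib

/-!
# Route «BalabanUVNodes» (K3⁷ `SpineGivenEndpointR13SepCoPH`, stmt-QuantumFields-20544), DAG node N16 = NE3, in-edge N07 → N16 —
# THE COMB (COMPLETE AXIAL) GAUGE CENTRED AT A SITE, ON THE ℓ¹-BALL OF RADIUS TWO: bond formulas and the covariant-difference letters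
# (kit for «the (9)_{β₀=1} gauge datum FROM gauge-invariant sup data», the converse of `RegularSupOfGauge.regularSup_of_localGauge`)

Cell `pub-ymgap`, width seat `pub-ymgap-dag-n16-w1` (director-ym №197 ∕ HUMAN RULING D-0149), generation 7, file 15 of this lineage
(files 12∕13∕14: `…N16SlotKeyNormalForm` p615276, `…N16SlotKeyQuarter` p618486, `…N16SlotKeyUnit` p620319).
`--kind proof --supports stmt-QuantumFields-20544 --as helper` (count-neutral).  `bears_on: R4∕N16 · edge N07 → N16`.
THEOREMS ONLY (0 `def`, 0 `sorry`, standard axioms), BY NAME over the Literature transcriptions `B7Prop1Explicit` (B7 (8)–(9): `hol`,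
`gaugeAct`, the comb `treeWord`∕`axialFn`, `ladder`, `lplaqWord`, `U1`), `B8Lemma1NonAbelian` (`lowPart`, the SHARP tree-gauge identity
`axial_bond_eq_sharp`, `axial_treeBond_eq_one`), `B7Prop9General` (`treeWord_split`, `treeWord_zsmul_e`), `T4AveragingDeficitWall` (`fhol`,
`Ad`, `covGrad`, `SmallField`, `IsUnitaryCfg`) and pub-balaban's `AveragingDeficitTransport` (`norm_Ad_of_unitary`, `u⁻¹ = u⋆`).

WHY (the lineage's slot key, files 9–14).  Node N07's debt to node N16 on the (β16) road is the SLOT KEY `stub_reg910Slot` of dag-n16-e's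
DischargeTest v6; by file 12 (`slotKey_iff_perSite`) its regularity clause (T9ˢ) is EXACTLY the G-free per-site statement (T9♭): at every
(8)-class minimiser `U` and every site `x`, the per-site (9)_{β₀=1} datum of pub-balaban's `MinimalActionHexDictionary.ExpGauge11 d U x α₀ α₁ α₂`
(a unitary `u` and a potential `a` with `U^u = exp a` on the bonds within `|·|₁ ≤ 2` of `x`, `‖a‖ ≤ α₀` there, `‖∇a‖ ≤ α₁` within `1`,
`‖∇∇a(x)‖ ≤ α₂`) with radii `(t∕L^{k+1}, t∕L^{2(k+1)}, t∕L^{3(k+1)})`, `t < B₃·M·ε₁`.  The tree has the direction «such gauges ⟹ the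
gauge-invariant sup regularity `RegularSup`» (`RegularSupOfGauge.regularSup_of_localGauge`, pub-balaban NE3 P1 gen 18) and flat inhabitants
(`MinimalActionHexDictionary.expGaugeCube11_flat`), but NOT the converse.  This file and its sequel (file 16 `…N16ExpGaugeOfSupData`) supply the
CONVERSE: the comb gauge CENTRED AT THE SITE ITSELF turns the gauge-invariant sup data «`SmallField U α` + covariant forward differences of
the plaquette variables `≤ γ`» into `ExpGauge11 d U x (2α + O(α²)) (α + γ + O(α²)) (γ + O(α²))`.  THIS FILE is the kinematic kit:

§1 (any group) — the comb splits at every direction (`treeWord_eq_append_lowPart`, from `B7Prop9General.treeWord_split`); in the comb gauge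
   `V₀ = U^{v₀}`, `v₀ = U(Γ_{x₀,·})`, the holonomy along the LOW part of the comb is trivial (`hol_axial_lowPart_eq_one`), hence ★
   `axial_bond_eq_conj_ladder`: `V₀(z, τ) = U(Γ_{x₀,w})·U(ladder over Γ(lowPart_τ(z − x₀)) from w)·U(Γ_{x₀,w})⁻¹`, `w = z − lowPart_τ(z − x₀)`
   (`axial_bond_eq_sharp` with its `V₀(Q)`-conjugation removed); the tree words of one and two letters (`treeWord_vec`, `treeWord_vec_add_vec`);
   and THE BOND FORMULAS ON THE BALL: `V₀(x₀, ·) = 1` (`axial_centre`); one letter `l` from the centre — `1` if `l.1 ≥ τ`, the elementary loop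
   `U(lplaqWord l τ)` at `x₀` if `l.1 < τ` (`axial_vec_of_not_lt` ∕ `axial_vec_of_lt`); two letters — `1` (both high), the loop of the low
   letter transported by the high bond (`axial_vec_add_vec_of_not_lt_of_lt`), or the two-rung ladder `Ad_{U(l₁)}[loop(l₂) at x₀ + l₁]·loop(l₁)`
   (both low, comb order; `axial_vec_add_vec_of_lt_of_lt`, via `hol_ladder_cons`).
§2 (`U(N)`, operator norm) — second-order conjugation `‖PXP⁻¹ − X‖ ≤ 2‖P − 1‖‖X − 1‖`, `‖Ad_V W′⁻¹ − W⁻¹‖ = ‖Ad_V W′ − W‖` (unitaries); the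
   elementary loops of both orientations against the tree's `fhol` (`hol_lplaqWord_false`, `hol_lplaqWord_true_eq_fhol`), `α`-close to `1`
   under `SmallField` (`norm_lplaq_sub_one_le`); and THE
   COVARIANT-DIFFERENCE LETTERS: forward loops transported by one bond differ by `≤ γ` (`norm_covDiff_lplaq_true_le` = the hypothesis
   `‖covGrad U (U(∂·)) x κ π‖ ≤ γ` read), backward loops by `≤ γ + 2α²` (`norm_covDiff_lplaq_false_le`: the inverse plaquettes at `p − e_j`,
   `p − e_j + e_i` compared through the two 2-bond paths around the plaquette `(j, i)` at `p − e_j` — a conjugation by that plaquette, second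
   order — plus `⋆`-invariance).

HONEST FRAMING.  Lattice kinematics of [Balaban1985Averaging] (8)–(9), pp. 24–25 (the comb∕axial gauge «`v₀(x) = V(Γ_{y,x})`», «`|V₀,b − 1| <
|b₋ − y|α₀`») on the tree's objects, [folklore] bookkeeping BY NAME; NOTHING of Bałaban's theorems asserted or refuted; no minimiser appears;
`stub_reg910Slot` NOT closed (its clause (iv) — bounded second covariant differences of the minimisers' plaquette field, [Balaban1985Variational]
Thm 1 (10)-type content — stays node N07's); no stub of K3⁷ v5 named or closed; N16 ∕ N07 NOT discharged; count-neutral; counts of record unmoved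
(typed 28∕28 · discharged 5∕27, A 5∕28); one finite four-torus at fixed `ε`, Bałaban AS PRINTED — NOT ℝ⁴, NOT infinite volume, NOT OS, NOT a mass
gap; the YM mass gap (Clay) is NOT proved by any of this — R4 closes the conditional finite-𝕋⁴ rung `BalabanLadder.UV` only.
-/

set_option autoImplicit false

open scoped BigOperators Matrix Matrix.Norms.L2Operator
open NormedSpace

namespace Summit.QuantumFields.YangMills.BalabanUVNodes.N16AxialGaugeBall

open Literature.MathematicalPhysics.QuantumFieldTheory.Balaban1983to89
open B7Prop1Explicit B7Prop2Explicit MatrixLog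
open T4AveragingDeficitWall hiding Site Plane Plaq Bond
open B8Lemma1NonAbelian (lowPart lowPart_apply lowPart_add axial_bond_eq_sharp axial_treeBond_eq_one)
open B7Prop9General (hiPart loPart treeWord_split treeWord_zsmul_e)
open Summit.QuantumFields.BalabanUV.T4Continuum
open AveragingDeficitTransport (mem_U1_of_unitary val_inv_eq_star_of_unitary norm_Ad_of_unitary)

noncomputable section

variable {d : ℕ}

/-! ## §1 The comb (complete axial) gauge centred at a site: group-level identities -/

section GroupLevel

variable {G : Type*} [Group G]

/-- The ladder loop is closed. [folklore] -/
theorem disp_ladder (Q : List (Letter d)) (τ : Fin d) : disp (ladder Q τ) = 0 := by simp [ladder]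

/-- `ladder [l] τ` is the elementary loop `lplaqWord l τ`. [folklore] -/
theorem ladder_singleton (l : Letter d) (τ : Fin d) : ladder [l] τ = lplaqWord l τ := by
  simp [ladder, revWord, lplaqWord]

/-- B8's `lowPart` is B7Prop9's `loPart` (same definition). [folklore] -/
theorem lowPart_eq_loPart (μ : Fin d) (v : Site d) : lowPart μ v = loPart μ v := rfl
/-- The tree word of `v` minus its low part at `μ` is the high part followed by the `μ`-segment. [folklore] -/
theorem treeWord_sub_lowPart (μ : Fin d) (v : Site d) :
    treeWord (v - lowPart μ v) = treeWord (hiPart μ v) ++ seg μ (v μ) := by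
  have h1 : hiPart μ (v - lowPart μ v) = hiPart μ v := by
    funext κ
    by_cases h : μ < κ
    · simp [hiPart, h, lowPart_apply, lt_asymm h]
    · simp [hiPart, h]
  have h2 : (v - lowPart μ v) μ = v μ := by simp [lowPart_apply]
  have h3 : loPart μ (v - lowPart μ v) = 0 := by
    funext κ
    by_cases h : κ < μ
    · simp [loPart, h, lowPart_apply]
    · simp [loPart, h]
  rw [treeWord_split μ (v - lowPart μ v), h1, h2, h3, treeWord_zero, List.append_nil]

/-- **The comb splits at every direction**: `Γ(v) = Γ(v − lowPart_μ v) ∪ Γ(lowPart_μ v)` as words. [folklore] -/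
theorem treeWord_eq_append_lowPart (μ : Fin d) (v : Site d) :
    treeWord v = treeWord (v - lowPart μ v) ++ treeWord (lowPart μ v) := by
  rw [treeWord_sub_lowPart, treeWord_split μ v, lowPart_eq_loPart]

/-- In the comb gauge centred at `x₀` the holonomy along the LOW part of the comb (from `z − lowPart_τ(z − x₀)` to `z`) is `1`. [folklore] -/
theorem hol_axial_lowPart_eq_one (U : Site d → Fin d → G) (x₀ z : Site d) (τ : Fin d) :
    hol (gaugeAct (axialFn U x₀) U) (z - lowPart τ (z - x₀)) (treeWord (lowPart τ (z - x₀))) = 1 := by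
  set v := z - x₀ with hv
  have h1 := hol_axial_treeWord U x₀ v
  have h2 := hol_axial_treeWord U x₀ (v - lowPart τ v)
  rw [treeWord_eq_append_lowPart τ v, hol_append, disp_treeWord, h2, one_mul] at h1
  have hw : x₀ + (v - lowPart τ v) = z - lowPart τ v := by rw [hv]; abel
  rwa [hw] at h1

/-- **THE COMB-GAUGE BOND FORMULA**: `V₀(z, τ) = U(Γ_{x₀,w}) · U(ladder over Γ(lowPart_τ(z − x₀)) from w) · U(Γ_{x₀,w})⁻¹`,
`w = z − lowPart_τ(z − x₀)` (`B8Lemma1NonAbelian.axial_bond_eq_sharp` + `hol_axial_lowPart_eq_one`). [folklore] -/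
theorem axial_bond_eq_conj_ladder (U : Site d → Fin d → G) (x₀ z : Site d) (τ : Fin d) :
    gaugeAct (axialFn U x₀) U z τ =
      axialFn U x₀ (z - lowPart τ (z - x₀)) *
        hol U (z - lowPart τ (z - x₀)) (ladder (treeWord (lowPart τ (z - x₀))) τ) *
        (axialFn U x₀ (z - lowPart τ (z - x₀)))⁻¹ := by
  rw [axial_bond_eq_sharp U x₀ z τ, hol_axial_lowPart_eq_one, inv_one, one_mul, mul_one,
    hol_gaugeAct_closed _ _ _ _ (disp_ladder _ _)]

/-- The tree word of a single letter is that letter. [folklore] -/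
theorem treeWord_vec (l : Letter d) : treeWord l.vec = [l] := by
  obtain ⟨κ, b⟩ := l
  cases b
  · have : Letter.vec ((κ, false) : Letter d) = (-1 : ℤ) • e κ := by simp
    rw [this, treeWord_zsmul_e]
    rfl
  · have : Letter.vec ((κ, true) : Letter d) = (1 : ℤ) • e κ := by simp
    rw [this, treeWord_zsmul_e]
    rfl

/-- The comb gauge function one letter away from the centre is that bond variable. [folklore] -/
theorem axialFn_vec (U : Site d → Fin d → G) (x₀ : Site d) (l : Letter d) :
    axialFn U x₀ (x₀ + l.vec) = stepHol U x₀ l := by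
  simp [axialFn, treeWord_vec]

/-- `lowPart_τ` of a single letter: the letter if its direction is `< τ`, else `0`. [folklore] -/
theorem lowPart_vec (τ : Fin d) (l : Letter d) :
    lowPart τ l.vec = if l.1 < τ then l.vec else 0 := by
  funext κ
  obtain ⟨μ, b⟩ := l
  cases b <;> by_cases h : μ < τ <;> by_cases hκ : κ = μ <;> simp [lowPart_apply, Letter.vec, e_apply, h, hκ]

/-- The tree word of two letters in decreasing direction order (or a repeated letter) is the two-letter word. [folklore] -/
theorem treeWord_vec_add_vec (l₁ l₂ : Letter d) (h : l₂.1 < l₁.1 ∨ l₂ = l₁) :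
    treeWord (l₁.vec + l₂.vec) = [l₁, l₂] := by
  rcases h with h | h
  · have hhi : hiPart l₁.1 (l₁.vec + l₂.vec) = 0 := by
      funext κ
      obtain ⟨μ₁, b₁⟩ := l₁; obtain ⟨μ₂, b₂⟩ := l₂
      simp only at h
      by_cases hκ : μ₁ < κ
      · have h1 : κ ≠ μ₁ := ne_of_gt hκ
        have h2 : κ ≠ μ₂ := ne_of_gt (h.trans hκ)
        cases b₁ <;> cases b₂ <;> simp [hiPart, hκ, Letter.vec, e_apply, h1, h2]
      · simp [hiPart, hκ]
    have hmid : (l₁.vec + l₂.vec) l₁.1 = (if l₁.2 then 1 else -1 : ℤ) := by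
      obtain ⟨μ₁, b₁⟩ := l₁; obtain ⟨μ₂, b₂⟩ := l₂
      simp only at h
      have h2 : μ₁ ≠ μ₂ := ne_of_gt h
      cases b₁ <;> cases b₂ <;> simp [Letter.vec, e_apply, h2]
    have hlo : loPart l₁.1 (l₁.vec + l₂.vec) = l₂.vec := by
      funext κ
      obtain ⟨μ₁, b₁⟩ := l₁; obtain ⟨μ₂, b₂⟩ := l₂
      simp only at h
      by_cases hκ : κ < μ₁
      · have h1 : κ ≠ μ₁ := ne_of_lt hκ
        cases b₁ <;> cases b₂ <;> simp [loPart, hκ, Letter.vec, e_apply, h1]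
      · have h2 : κ ≠ μ₂ := fun h' => hκ (h' ▸ h)
        cases b₁ <;> cases b₂ <;> simp [loPart, hκ, Letter.vec, e_apply, h2]
    rw [treeWord_split l₁.1, hhi, hmid, hlo, treeWord_zero, treeWord_vec, List.nil_append]
    obtain ⟨μ₁, b₁⟩ := l₁
    cases b₁ <;> rfl
  · subst h
    obtain ⟨μ, b⟩ := l₂
    cases b
    · have : Letter.vec ((μ, false) : Letter d) + Letter.vec ((μ, false) : Letter d) = (-2 : ℤ) • e μ := by
        rw [Letter.vec_false, show (-2 : ℤ) = -(2 : ℤ) from rfl, neg_zsmul, two_zsmul, neg_add]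
      rw [this, treeWord_zsmul_e]; rfl
    · have : Letter.vec ((μ, true) : Letter d) + Letter.vec ((μ, true) : Letter d) = (2 : ℤ) • e μ := by
        rw [Letter.vec_true, two_zsmul]
      rw [this, treeWord_zsmul_e]; rfl

/-! ### The bond formulas on the `ℓ¹`-ball of radius two about the centre -/

/-- (F0) At the centre every bond variable of the comb gauge is `1`. [folklore] -/
theorem axial_centre (U : Site d → Fin d → G) (x₀ : Site d) (τ : Fin d) : gaugeAct (axialFn U x₀) U x₀ τ = 1 :=
  axial_treeBond_eq_one U x₀ x₀ τ (by simp)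

/-- (F1, high) One letter `l` from the centre with `l.1 ≥ τ`: a tree bond, `V₀ = 1`. [folklore] -/
theorem axial_vec_of_not_lt (U : Site d → Fin d → G) (x₀ : Site d) {l : Letter d} {τ : Fin d} (h : ¬ l.1 < τ) :
    gaugeAct (axialFn U x₀) U (x₀ + l.vec) τ = 1 :=
  axial_treeBond_eq_one U x₀ _ τ (by rw [add_sub_cancel_left, lowPart_vec, if_neg h])

/-- (F1, low) One letter `l` from the centre with `l.1 < τ`: `V₀(x₀ + l, τ)` is the elementary loop `U(lplaqWord l τ)`
at the centre (a plaquette, or a conjugated inverse plaquette for a backward letter). [folklore] -/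
theorem axial_vec_of_lt (U : Site d → Fin d → G) (x₀ : Site d) {l : Letter d} {τ : Fin d} (h : l.1 < τ) :
    gaugeAct (axialFn U x₀) U (x₀ + l.vec) τ = hol U x₀ (lplaqWord l τ) := by
  have hlo : lowPart τ (x₀ + l.vec - x₀) = l.vec := by rw [add_sub_cancel_left, lowPart_vec, if_pos h]
  have h1 : axialFn U x₀ x₀ = 1 := by simp [axialFn]
  rw [axial_bond_eq_conj_ladder, hlo, add_sub_cancel_right, h1, treeWord_vec, ladder_singleton]
  simp

/-- (F2, high–high) Two letters of directions `≥ τ`: a tree bond, `V₀ = 1`. [folklore] -/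
theorem axial_vec_add_vec_of_not_lt_of_not_lt (U : Site d → Fin d → G) (x₀ : Site d) {l₁ l₂ : Letter d} {τ : Fin d}
    (h₁ : ¬ l₁.1 < τ) (h₂ : ¬ l₂.1 < τ) : gaugeAct (axialFn U x₀) U (x₀ + l₁.vec + l₂.vec) τ = 1 :=
  axial_treeBond_eq_one U x₀ _ τ (by
    rw [show x₀ + l₁.vec + l₂.vec - x₀ = l₁.vec + l₂.vec by abel, lowPart_add, lowPart_vec, lowPart_vec,
      if_neg h₁, if_neg h₂, add_zero])

/-- (F2, high–low) `l₁.1 ≥ τ > l₂.1`: the elementary loop of `l₂` at `x₀ + l₁`, transported to the centre by the bond `l₁`. [folklore] -/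
theorem axial_vec_add_vec_of_not_lt_of_lt (U : Site d → Fin d → G) (x₀ : Site d) {l₁ l₂ : Letter d} {τ : Fin d}
    (h₁ : ¬ l₁.1 < τ) (h₂ : l₂.1 < τ) :
    gaugeAct (axialFn U x₀) U (x₀ + l₁.vec + l₂.vec) τ =
      stepHol U x₀ l₁ * hol U (x₀ + l₁.vec) (lplaqWord l₂ τ) * (stepHol U x₀ l₁)⁻¹ := by
  have hlo : lowPart τ (x₀ + l₁.vec + l₂.vec - x₀) = l₂.vec := by
    rw [show x₀ + l₁.vec + l₂.vec - x₀ = l₁.vec + l₂.vec by abel, lowPart_add, lowPart_vec, lowPart_vec,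
      if_neg h₁, if_pos h₂, zero_add]
  rw [axial_bond_eq_conj_ladder, hlo, add_sub_cancel_right, axialFn_vec, treeWord_vec, ladder_singleton]

/-- (F2, low–low) Two letters of directions `< τ` in comb order (`l₂.1 < l₁.1`, or a repeated letter): the two-rung ladder — the
loop of `l₂` at `x₀ + l₁` transported by the bond `l₁`, times the loop of `l₁` at the centre (`hol_ladder_cons`). [folklore] -/
theorem axial_vec_add_vec_of_lt_of_lt (U : Site d → Fin d → G) (x₀ : Site d) {l₁ l₂ : Letter d} {τ : Fin d}
    (h₁ : l₁.1 < τ) (h₂ : l₂.1 < τ) (h : l₂.1 < l₁.1 ∨ l₂ = l₁) :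
    gaugeAct (axialFn U x₀) U (x₀ + l₁.vec + l₂.vec) τ =
      (stepHol U x₀ l₁ * hol U (x₀ + l₁.vec) (lplaqWord l₂ τ) * (stepHol U x₀ l₁)⁻¹) * hol U x₀ (lplaqWord l₁ τ) := by
  have hlo : lowPart τ (x₀ + l₁.vec + l₂.vec - x₀) = l₁.vec + l₂.vec := by
    rw [show x₀ + l₁.vec + l₂.vec - x₀ = l₁.vec + l₂.vec by abel, lowPart_add, lowPart_vec, lowPart_vec,
      if_pos h₁, if_pos h₂]
  have h1 : axialFn U x₀ x₀ = 1 := by simp [axialFn]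
  rw [axial_bond_eq_conj_ladder, hlo, show x₀ + l₁.vec + l₂.vec - (l₁.vec + l₂.vec) = x₀ by abel, h1,
    treeWord_vec_add_vec l₁ l₂ h, show [l₁, l₂] = l₁ :: [l₂] from rfl, hol_ladder_cons, ladder_singleton]
  simp

end GroupLevel

/-! ## §2 Norm kit on `U(N)`-valued data (operator norm (19)) -/

section NormLevel

variable {n : Type*} [Fintype n] [DecidableEq n] [Nonempty n]

/-- `U(N) ⊂ U1`: a unitary configuration is `U1`-valued. [folklore] -/
theorem u1_of_isUnitaryCfg {U : Site d → Fin d → (Matrix n n ℂ)ˣ} (hU : IsUnitaryCfg U) : ∀ x κ, U x κ ∈ U1 (Matrix n n ℂ) :=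
  fun x κ => mem_U1_of_unitary (hU x κ)

/-- `‖P X P⁻¹ − X‖ ≤ 2‖P − 1‖·‖X − 1‖` for `P ∈ U1` — conjugation by a near-identity moves near-identity elements at
SECOND order (`P X P⁻¹ − X = (P−1)(X−1)P⁻¹ + (X−1)(P⁻¹−1)`). [folklore] -/
theorem norm_conj_sub_self_le {P : (Matrix n n ℂ)ˣ} (hP : P ∈ U1 (Matrix n n ℂ)) (X : Matrix n n ℂ) :
    ‖(P : Matrix n n ℂ) * X * ((P⁻¹ : (Matrix n n ℂ)ˣ) : Matrix n n ℂ) - X‖ ≤ 2 * ‖(P : Matrix n n ℂ) - 1‖ * ‖X - 1‖ := by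
  have h1 : (P : Matrix n n ℂ) * ((P⁻¹ : (Matrix n n ℂ)ˣ) : Matrix n n ℂ) = 1 := Units.mul_inv P
  have e1 : (P : Matrix n n ℂ) * X * ((P⁻¹ : (Matrix n n ℂ)ˣ) : Matrix n n ℂ) - X
      = ((P : Matrix n n ℂ) - 1) * (X - 1) * ((P⁻¹ : (Matrix n n ℂ)ˣ) : Matrix n n ℂ) + (X - 1) * (((P⁻¹ : (Matrix n n ℂ)ˣ) : Matrix n n ℂ) - 1) := by
    have : ((P : Matrix n n ℂ) - 1) * (X - 1) * ((P⁻¹ : (Matrix n n ℂ)ˣ) : Matrix n n ℂ) + (X - 1) * (((P⁻¹ : (Matrix n n ℂ)ˣ) : Matrix n n ℂ) - 1)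
        = (P : Matrix n n ℂ) * X * ((P⁻¹ : (Matrix n n ℂ)ˣ) : Matrix n n ℂ) - X - ((P : Matrix n n ℂ) * ((P⁻¹ : (Matrix n n ℂ)ˣ) : Matrix n n ℂ) - 1) := by noncomm_ring
    rw [this, h1, sub_self, sub_zero]
  rw [e1]
  have hi := norm_inv_sub_one_le hP
  calc _ ≤ ‖((P : Matrix n n ℂ) - 1) * (X - 1) * ((P⁻¹ : (Matrix n n ℂ)ˣ) : Matrix n n ℂ)‖ + ‖(X - 1) * (((P⁻¹ : (Matrix n n ℂ)ˣ) : Matrix n n ℂ) - 1)‖ := norm_add_le _ _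
    _ ≤ ‖(P : Matrix n n ℂ) - 1‖ * ‖X - 1‖ * ‖((P⁻¹ : (Matrix n n ℂ)ˣ) : Matrix n n ℂ)‖ + ‖X - 1‖ * ‖((P⁻¹ : (Matrix n n ℂ)ˣ) : Matrix n n ℂ) - 1‖ :=
        add_le_add ((norm_mul_le _ _).trans (mul_le_mul_of_nonneg_right (norm_mul_le _ _) (norm_nonneg _)))
          (norm_mul_le _ _)
    _ ≤ ‖(P : Matrix n n ℂ) - 1‖ * ‖X - 1‖ * 1 + ‖X - 1‖ * ‖(P : Matrix n n ℂ) - 1‖ := by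
        gcongr
        exact hP.2
    _ = 2 * ‖(P : Matrix n n ℂ) - 1‖ * ‖X - 1‖ := by ring

omit [Nonempty n] in
/-- For unitary `V, W, W′`: `‖Ad_V (W′⁻¹) − W⁻¹‖ = ‖Ad_V W′ − W‖` (inverse = adjoint, `Ad_V` commutes with the adjoint,
the norm is `⋆`-invariant). [folklore] -/
theorem norm_Ad_inv_sub_inv {V W W' : (Matrix n n ℂ)ˣ} (hV : V ∈ unitaryUnits (Matrix n n ℂ)) (hW : W ∈ unitaryUnits (Matrix n n ℂ))
    (hW' : W' ∈ unitaryUnits (Matrix n n ℂ)) :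
    ‖Ad V ((W'⁻¹ : (Matrix n n ℂ)ˣ) : Matrix n n ℂ) - ((W⁻¹ : (Matrix n n ℂ)ˣ) : Matrix n n ℂ)‖ = ‖Ad V (W' : Matrix n n ℂ) - (W : Matrix n n ℂ)‖ := by
  have hVs := val_inv_eq_star_of_unitary hV
  have e1 : Ad V ((W'⁻¹ : (Matrix n n ℂ)ˣ) : Matrix n n ℂ) - ((W⁻¹ : (Matrix n n ℂ)ˣ) : Matrix n n ℂ) = star (Ad V (W' : Matrix n n ℂ) - (W : Matrix n n ℂ)) := by
    unfold Ad
    rw [val_inv_eq_star_of_unitary hW,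
      val_inv_eq_star_of_unitary hW', hVs, star_sub, star_mul, star_mul, star_star,
      mul_assoc]
  rw [e1, norm_star]

/-! ### Plaquette letters of a unitary small-field configuration -/

/-- The elementary loop of a backward letter `−e_j` from `p` is the inverse plaquette at `p − e_j` conjugated back by the
bond `⟨p − e_j, p⟩`. [folklore] -/
theorem hol_lplaqWord_false {G : Type*} [Group G] (U : Site d → Fin d → G) (p : Site d) (j τ : Fin d) :
    hol U p (lplaqWord (j, false) τ) = (U (p - e j) j)⁻¹ * (hol U (p - e j) (plaqWord j τ))⁻¹ * U (p - e j) j := by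
  simp only [lplaqWord, plaqWord, hol_cons, hol_nil, mul_one, stepHol_true, stepHol_false, Letter.rev_mk,
    Bool.not_false, Letter.vec_true, Letter.vec_false, mul_inv_rev, inv_inv]
  abel_nf
  group

omit [Nonempty n] in
/-- The elementary loop of a forward letter `+e_j` from `p`, `j < τ`, is the tree's plaquette variable `U(∂p_{p;(j,τ)})`.
[folklore] -/
theorem hol_lplaqWord_true_eq_fhol (U : Site d → Fin d → (Matrix n n ℂ)ˣ) (p : Site d) {j τ : Fin d} (h : j < τ) :
    hol U p (lplaqWord (j, true) τ) = fhol U (p, ⟨(j, τ), h⟩) := rfl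

/-- Every elementary loop is `α`-close to `1` under `SmallField U α` (`B7Prop1Explicit.norm_hol_lplaqWord_sub_one_le`).
[folklore] -/
theorem norm_lplaq_sub_one_le {U : Site d → Fin d → (Matrix n n ℂ)ˣ} {α : ℝ} (hU : IsUnitaryCfg U) (hS : SmallField U α) (p : Site d) (l : Letter d) (τ : Fin d)
    (hl : l.1 ≠ τ) : ‖((hol U p (lplaqWord l τ) : (Matrix n n ℂ)ˣ) : Matrix n n ℂ) - 1‖ ≤ α :=
  norm_hol_lplaqWord_sub_one_le U (u1_of_isUnitaryCfg hU) hS p l τ hl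

omit [Nonempty n] in
/-- **THE COVARIANT-DIFFERENCE LETTER, FORWARD LOOPS**: the hypothesis «covariant forward differences of the plaquette
variables are `≤ γ`» read on the elementary loop of `+e_j`, `j < τ`, transported by the bond `⟨p, p + e_i⟩`. [folklore] -/
theorem norm_covDiff_lplaq_true_le {U : Site d → Fin d → (Matrix n n ℂ)ˣ} {γ : ℝ}
    (hγ : ∀ (x : Site d) (κ : Fin d) (π : T4AveragingDeficitWall.Plane d),
      ‖covGrad U (fun q => ((fhol U q : (Matrix n n ℂ)ˣ) : Matrix n n ℂ)) x κ π‖ ≤ γ)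
    (p : Site d) (i : Fin d) {j τ : Fin d} (h : j < τ) :
    ‖Ad (U p i) ((hol U (p + e i) (lplaqWord (j, true) τ) : (Matrix n n ℂ)ˣ) : Matrix n n ℂ)
        - ((hol U p (lplaqWord (j, true) τ) : (Matrix n n ℂ)ˣ) : Matrix n n ℂ)‖ ≤ γ :=
  hγ p i ⟨(j, τ), h⟩

/-- **THE COVARIANT-DIFFERENCE LETTER, BACKWARD LOOPS**: the loop of `−e_j` (`j < τ`) transported by `⟨p, p + e_i⟩`, `i ≠ j`, moves by
`≤ γ + 2α²` (inverse plaquettes at `p − e_j`, `p − e_j + e_i` compared around the plaquette `(j, i)` at `p − e_j`, + `⋆`-invariance). [folklore] -/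
theorem norm_covDiff_lplaq_false_le {U : Site d → Fin d → (Matrix n n ℂ)ˣ} {α γ : ℝ} (hU : IsUnitaryCfg U) (hα : 0 ≤ α)
    (hS : SmallField U α)
    (hγ : ∀ (x : Site d) (κ : Fin d) (π : T4AveragingDeficitWall.Plane d),
      ‖covGrad U (fun q => ((fhol U q : (Matrix n n ℂ)ˣ) : Matrix n n ℂ)) x κ π‖ ≤ γ)
    (p : Site d) {i j τ : Fin d} (h : j < τ) (hij : i ≠ j) :
    ‖Ad (U p i) ((hol U (p + e i) (lplaqWord (j, false) τ) : (Matrix n n ℂ)ˣ) : Matrix n n ℂ)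
        - ((hol U p (lplaqWord (j, false) τ) : (Matrix n n ℂ)ˣ) : Matrix n n ℂ)‖ ≤ γ + 2 * α ^ 2 := by
  -- `q = p − e_j`; forward plaquettes `W(q)`, `W(q + e_i)` in the plane `(j, τ)`; the plaquette `P` at `q` in the plane `(j, i)`
  set q : Site d := p - e j with hq
  have hpq : p = q + e j := by rw [hq, sub_add_cancel]
  have hq' : p + e i - e j = q + e i := by rw [hq]; abel
  have hV1 := u1_of_isUnitaryCfg hU
  rw [hol_lplaqWord_false, hol_lplaqWord_false, hq']
  set W : (Matrix n n ℂ)ˣ := hol U q (plaqWord j τ) with hW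
  set W' : (Matrix n n ℂ)ˣ := hol U (q + e i) (plaqWord j τ) with hW'
  set P : (Matrix n n ℂ)ˣ := hol U q (plaqWord j i) with hP
  have hWu : W ∈ unitaryUnits (Matrix n n ℂ) := hol_mem_of hU _ _
  have hW'u : W' ∈ unitaryUnits (Matrix n n ℂ) := hol_mem_of hU _ _
  -- the path identity `U(p,i) U(q+e_i,j)⁻¹ = U(q,j)⁻¹ P U(q,i)`
  have hpath : U p i * (U (q + e i) j)⁻¹ = (U q j)⁻¹ * P * U q i := by
    rw [hP, hpq]
    simp only [plaqWord, hol_cons, hol_nil, mul_one, stepHol_true, stepHol_false, Letter.vec_true,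
      Letter.vec_false]
    rw [show q + e j + e i + -e j = q + e i by abel]
    group
  -- the transported loop, as a group element
  have hgrp : (U p i * ((U (q + e i) j)⁻¹ * W'⁻¹ * U (q + e i) j) * (U p i)⁻¹ : (Matrix n n ℂ)ˣ)
      = (U q j)⁻¹ * (P * (U q i * W'⁻¹ * (U q i)⁻¹) * P⁻¹) * U q j := by
    have h2 : (U (q + e i) j) * (U p i)⁻¹ = (U q i)⁻¹ * P⁻¹ * U q j := by
      have := congrArg (·⁻¹) hpath
      simpa only [mul_inv_rev, inv_inv, mul_assoc] using this
    calc (U p i * ((U (q + e i) j)⁻¹ * W'⁻¹ * U (q + e i) j) * (U p i)⁻¹ : (Matrix n n ℂ)ˣ)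
        = (U p i * (U (q + e i) j)⁻¹) * W'⁻¹ * (U (q + e i) j * (U p i)⁻¹) := by group
      _ = ((U q j)⁻¹ * P * U q i) * W'⁻¹ * ((U q i)⁻¹ * P⁻¹ * U q j) := by rw [hpath, h2]
      _ = _ := by group
  -- pass to matrices: the difference is `Ad_{U(q,j)⁻¹}` of `P Z P⁻¹ − W⁻¹`, `Z = Ad_{U(q,i)} W'⁻¹`
  set Z : Matrix n n ℂ := Ad (U q i) ((W'⁻¹ : (Matrix n n ℂ)ˣ) : Matrix n n ℂ) with hZ
  have e1 : Ad (U p i) ((((U (q + e i) j)⁻¹ * W'⁻¹ * U (q + e i) j : (Matrix n n ℂ)ˣ)) : Matrix n n ℂ)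
        - ((((U q j)⁻¹ * W⁻¹ * U q j : (Matrix n n ℂ)ˣ)) : Matrix n n ℂ)
      = Ad ((U q j)⁻¹) ((P : Matrix n n ℂ) * Z * ((P⁻¹ : (Matrix n n ℂ)ˣ) : Matrix n n ℂ) - ((W⁻¹ : (Matrix n n ℂ)ˣ) : Matrix n n ℂ)) := by
    have hAd : Ad (U p i) ((((U (q + e i) j)⁻¹ * W'⁻¹ * U (q + e i) j : (Matrix n n ℂ)ˣ)) : Matrix n n ℂ)
        = (((U p i * ((U (q + e i) j)⁻¹ * W'⁻¹ * U (q + e i) j) * (U p i)⁻¹ : (Matrix n n ℂ)ˣ)) : Matrix n n ℂ) := by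
      unfold Ad; simp only [Units.val_mul]
    rw [hAd, hgrp, hZ]
    unfold Ad
    simp only [Units.val_mul, inv_inv, mul_sub, sub_mul, mul_assoc]
  rw [e1, norm_Ad_of_unitary ((unitaryUnits (Matrix n n ℂ)).inv_mem (hU q j))]
  -- split: conjugation by the plaquette `P` (second order) + the inverse covariant difference (= forward letter)
  have hZ1 : ‖Z - 1‖ ≤ α := by
    have : Z - 1 = Ad (U q i) (((W'⁻¹ : (Matrix n n ℂ)ˣ) : Matrix n n ℂ) - 1) := by
      rw [hZ]; unfold Ad; rw [mul_sub, sub_mul, mul_one, Units.mul_inv]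
    rw [this, norm_Ad_of_unitary (hU q i)]
    exact (norm_inv_sub_one_le (hol_mem hV1 _ _)).trans (hS (q + e i) j τ (ne_of_lt h))
  have hP1 : ‖(P : Matrix n n ℂ) - 1‖ ≤ α := hS q j i (Ne.symm hij)
  have hPu : P ∈ U1 (Matrix n n ℂ) := hol_mem hV1 _ _
  calc ‖(P : Matrix n n ℂ) * Z * ((P⁻¹ : (Matrix n n ℂ)ˣ) : Matrix n n ℂ) - ((W⁻¹ : (Matrix n n ℂ)ˣ) : Matrix n n ℂ)‖
      = ‖((P : Matrix n n ℂ) * Z * ((P⁻¹ : (Matrix n n ℂ)ˣ) : Matrix n n ℂ) - Z) + (Z - ((W⁻¹ : (Matrix n n ℂ)ˣ) : Matrix n n ℂ))‖ := by rw [sub_add_sub_cancel]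
    _ ≤ ‖(P : Matrix n n ℂ) * Z * ((P⁻¹ : (Matrix n n ℂ)ˣ) : Matrix n n ℂ) - Z‖ + ‖Z - ((W⁻¹ : (Matrix n n ℂ)ˣ) : Matrix n n ℂ)‖ := norm_add_le _ _
    _ ≤ 2 * ‖(P : Matrix n n ℂ) - 1‖ * ‖Z - 1‖ + γ := by
        refine add_le_add (norm_conj_sub_self_le hPu Z) ?_
        rw [hZ, norm_Ad_inv_sub_inv (hU q i) hWu hW'u]
        exact hγ q i ⟨(j, τ), h⟩
    _ ≤ 2 * α * α + γ := by gcongr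
    _ = γ + 2 * α ^ 2 := by ring

end NormLevel

end

end Summit.QuantumFields.YangMills.BalabanUVNodes.N16AxialGaugeBall
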